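import Summits.QuantumFields.YangMills.Theorems.BalabanUVNodesN16Thm4OutputPrint
import Summits.QuantumFields.BalabanUV.T4Continuum.Spine.NE3.PairClassAkB8
import Summits.QuantumFields.BalabanUV.T4Continuum.Spine.NE3.PairReg335B8
import Summits.QuantumFields.BalabanUV.T4Continuum.Spine.NE3.PairFrameCondition
import HarnessLib

/-!
# Route «BalabanUVNodes» (K4 «SpineRates»), DAG node N16 = NE3 — [B8] THEOREM 4 (all-torus geometry, `B8Thm4TorusAt.Thm4TorusAt`) WITH ITS CONCLUSION
# SLOT `Concl` WRITTEN OUT CONCRETELY in print's (1.36)∕(1.38)∕(1.39) letters — NO Concl-dictionary binder: (T4ᵀ_print) ∧ N07's (H3ˢᵘᵖ) ⟹ N16 ∕ DECL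

Cell `pub-ymgap`, seat `pub-ymgap-dag-n16-a` (KNIT-BY-NAME, D-0062; chair R424 venue), generation 4, file 13; `--supports stmt-QuantumFields-19182`; `bears_on:
R4∕N16 · edge N05 → N16`.  File 11 (`…N16PrintLetters`) converted every member of the edge binder into print's ∕ node N05's letters; file 10 (`…N16Thm4Torus`)
put the torus-geometry interface (T4ᵀ) in place with `Concl` FREE plus (DICT₁₃₈) (ref-B READ #277∕#285 pin: with `Concl` free, (T4ᵀ, DICT) carry N05's content
JOINTLY).  HERE the slot is filled: `Concl := fun α₀ α₁ U₀ U′ u ↦ ∃ A` self-adjoint, `(N·Lᵏ)`-periodic, `mgauge U₀ u (cfgExp η A) = U′` («U₁ = U′^{u⁻¹} = e^{iηA}»),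
(1.36)₁ `‖A‖ ≤ B(α₀+α₁)`, (1.36)₂ `‖D^η_{U₀,μ}A_κ‖ ≤ B(α₀+α₁)` (`covDerivFwd`), (1.38) `IsLandau138 L k η univ (torusLam k) U₀ A`, (1.36)₃ at nearest-neighbour
distance along `μ`: `‖Ad_{U₀(y,μ)}(D^η_{U₀,μ}A_κ)(y+e_μ) − D^η_{U₀,μ}A_κ(y)‖ ≤ B_h(α₀+α₁)·ξᵏ` (reading (R-f), `β = 1` = [Balaban1985Variational] (9)'s `β₀ = 1`,
census caveat (c2)), (1.39)₁ `‖Δ^η_{U₀}A_κ‖ ≤ B(α₀+α₁)` (`covLap`) — all at `j = k`, `Lᵏη = 1`; `B ↦ B₁ = 5dLB₀`, `B_h ↦ B₂(β₀)` of Prop. 3 p. 87 are PARAMETERS.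
§1 `thm4OutputPrint_of_thm4TorusAt_print` (any `d ≥ 1`): (T4ᵀ_print) ∧ (H3ˢᵘᵖ) ⟹ (OUT_print) at `s = g′ = ℓ = B(α + 11d²α)`, `hol = B_h(α + 11d²α)` — file 10 §1's modus
ponens (`inAk_pair`, `reg335Zd_rescale_bavg`, `concl_of_thm4TorusAt_pair`) with the concrete slot read off directly.
§2 `n16_of_thm4TorusAt_print` (`d = 4`): THE EDGE OF RECORD WITH PRINT's THEOREM 4 AS ITS ONLY N05-SIDE HYPOTHESIS — `∃ r > 0, ∀ g > 0, ∃ C ≥ 0` (THE END's,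
independent of Thm 4's constants), `∀ (c₁, B, B_h)`, `∀ b′ c′` ((Rb), `c′`-line), `∀ α` in the DISPLAYED window (`C₀α ≤ ⅓`, `2α ≤ c₂′`, `176α ≤ ⅙`,
`177α ≤ c₁`, the two leaf lines `< α`),
the (3.35) schedule, `∀ 0 < ε ≤ r` with `ε < α`, `0 ≤ s₁ ≤ r`, `0 ≤ b ≤ ε∕2`, `s₂`, four k-free letter lines placing `177Bα` below `s₁` and `177B_hα` below `s₂`: (T4ᵀ_print) → ∀ `dom`, `LeafH3sup` →
`NE3EnergyRateWCov 4 (sfClass 4 L N ε) L N b g C s₁ s₂ dom` (file 12 §1's road ∘ §1).  (`α` is free because Thm 4's output size `B(α₀+α₁)` must sit below THE END's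
radius `r`.)  §3 `ne3Shape_of_thm4TorusAt_print` (`d = 4`): the DECL column likewise (file 12 §2's road ∘ §1, g2's numeric regime).
HONEST FRAMING: bookkeeping by name; (T4ᵀ_print) = [Balaban1985RegularSpaces] Thm 4 + Prop 3 (p. 88∕87), torus case p. 77, at CURVED backgrounds — node N05's
theorem, NOT proved in the tree; (H3ˢᵘᵖ) = N07's [Balaban1985Variational] Thm 1 TYPE; N16 ∕ NE3 NOT discharged; count-neutral; finite T⁴ at fixed ε — NOT ℝ⁴,
NOT infinite volume, NOT OS, NOT a mass gap, NOT Clay.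
-/

set_option autoImplicit false

open scoped BigOperators Matrix Matrix.Norms.L2Operator
open NormedSpace

namespace Summit.QuantumFields.YangMills.BalabanUVNodes.N16

open Literature.MathematicalPhysics.QuantumFieldTheory.Balaban1983to89
open B7Prop1Explicit B7Prop2Explicit
open T4AveragingDeficitWall (IsUnitaryCfg Ad fineAction blockSites)
open T4AveragingDeficitWallBoundary (periodBox)
open T4EtaRateMin (NE3Shape)
open B8Lemma1NonAbelian (pert)
open B7Eq92Concrete (mgauge)
open B8Ineq132 (covDerivFwd InAk)
open B8Eq146AExpansion (iEta)
open B8Eq184Proof (cfgExp)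
open B8Eq119TwistedAxial (Restr129)
open B8Eq166ConstraintPair (ptw)
open B8Eq133Hypotheses (Reg335Zd)
open B8Eq138LandauZd (covLap IsLandau138)
open B8Thm4TorusAt (torusLam torusLam_self Thm4TorusAt concl_of_thm4TorusAt_pair)
open B12Ineq417Flat (shiftCfg)
open Summit.QuantumFields.BalabanUV.T4Continuum
open MinimalActionSandwich (IsMinimiser)
open MinimalActionRate (Regular sfClass rescale_bavg_mem_sfClass minActReadings)
open MinimalActionRefine (RegularSup gradConst)
open BlockAverageCurrent (curConst curConst_nonneg)
open NE3EnergyShapes (IsPeriodicSite)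
open NE3EnergyWeightedCovShape (NE3EnergyRateWCov)
open NE3RightInverseSupLetters (frameC)
open NE3.LeafIndexSockets (LeafH3sup)
open NE3.SupplierB8SfClassPrep (pdev_le_of_smallField)
open NE3.RemainderTowerPrepB8 (shiftCfg_of_isPeriodicCfg)
open NE3.PairFrameCondition (avgIter_eq_of_isMinimiser avgIter_rescale_bavg_eq_of_isMinimiser)
open NE3.PairClassAkB8 (inAk_pair)
open NE3.PairReg335B8 (reg335Zd_rescale_bavg)

noncomputable section

variable {d : ℕ} {n : Type*} [Fintype n] [DecidableEq n]

/-! ## §1 Theorem 4 (torus geometry) with the CONCRETE conclusion slot yields (OUT_print), any dimension -/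

/-- **(T4ᵀ_print) ∧ (H3ˢᵘᵖ) ⟹ (OUT_print)** (`d ≥ 1`, `L ≥ 2`; letters as in file 10 §1; Thm 4's constants `B`, `B_h`; Hölder exponent `β`).  `Thm4TorusAt L k (N·Lᵏ)
(Lᵏ)⁻¹ c₁ unitaryUnits (Reg335Zd (Lᵏ)⁻¹ L (𝒬 k) C) (Restr129 L k (torusLam k)) Concl_print` at every `k ≥ 1`, with `Concl_print` the inline reading of (1.36)∕(1.38)∕(1.39)
in print's letters (module docstring), applied at the pair `(W, U_A)` from row NE3's leaf data ALONE (file 10 §1's three steps), gives (OUT_print) at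
`s = g′ = ℓ = B(α + 11d²α)`, `hol = B_h(α + 11d²α)`.  No existence is proved: (T4ᵀ_print) is the hypothesis. [folklore] -/
theorem thm4OutputPrint_of_thm4TorusAt_print [Nonempty n] (hd : 1 ≤ d) {L N : ℕ} (hL : 2 ≤ L) {ε b g b' c' α c₁ B Bh β : ℝ}
    (hε : 0 ≤ ε) (hb' : 0 ≤ b') (hc' : 0 ≤ c') (hb'1 : b' ≤ 1) (hRb : 2 ^ 15 * ((d : ℝ) + 1) ^ 2 * ((d : ℝ) + 4) ^ 2 * (L : ℝ) ^ 2 * b' ≤ 1)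
    (hb'α : b' + 226 * (8 * (d + 1) * (d + 4)) ^ 2 * b' ^ 2 < α) (hc'α : 4 * ((d : ℝ) - 1) * (c' + curConst d L * b' ^ 2) < α)
    (hα : 0 < α) (hεα : ε < α) (hα3 : C0 d * α ≤ 1 / 3) (hα2 : 2 * α ≤ c2' d L) (hsmall : 11 * (d : ℝ) ^ 2 * α ≤ 1 / 6)
    (hc₁ : α + 11 * (d : ℝ) ^ 2 * α ≤ c₁)
    {Mc : ℝ} (hMc : 0 ≤ Mc) (hMcα : (Mc + 1) * (b' + 226 * (8 * (d + 1) * (d + 4)) ^ 2 * b' ^ 2) ≤ 1 / 2)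
    {𝒬 : ℕ → Set (Set (Site d) × ℕ)}
    (h𝒬 : ∀ k, ∀ q ∈ 𝒬 k, q.2 ≤ k ∧ ∃ y : Site d, ∀ z ∈ q.1, (l1 (z - y) : ℝ) ≤ Mc * (L : ℝ) ^ q.2)
    {C : ℝ} (hC : 2 * (Mc + 1) * (b' + 226 * (8 * (d + 1) * (d + 4)) ^ 2 * b' ^ 2) + 2 * Mc * (2 * (c' + curConst d L * b' ^ 2)) +
      4 * Mc * (1 + 2 * Mc) * (b' + 226 * (8 * (d + 1) * (d + 4)) ^ 2 * b' ^ 2) ^ 2 < C)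
    (hT4 : ∀ k, 1 ≤ k → Thm4TorusAt L k (((N * L ^ k : ℕ) : ℤ)) (((L : ℝ) ^ k)⁻¹) c₁ (unitaryUnits (Matrix n n ℂ))
      (Reg335Zd (((L : ℝ) ^ k)⁻¹) L (𝒬 k) C) (Restr129 L k (torusLam k))
      (fun (α₀ α₁ : ℝ) (U₀ U' : Site d → Fin d → (Matrix n n ℂ)ˣ) (u : Site d → (Matrix n n ℂ)ˣ) =>
        ∃ A : Site d → Fin d → Matrix n n ℂ,
          (∀ x μ, IsSelfAdjoint (A x μ)) ∧ (∀ (x : Site d) (κ μ : Fin d), A (x + (((N * L ^ k : ℕ) : ℤ)) • e κ) μ = A x μ) ∧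
          mgauge U₀ u (cfgExp (((L : ℝ) ^ k)⁻¹) A) = U' ∧
          (∀ x μ, ‖A x μ‖ ≤ B * (α₀ + α₁)) ∧
          (∀ (μ : Fin d) (x : Site d) (κ : Fin d), ‖covDerivFwd (((L : ℝ) ^ k)⁻¹) U₀ μ (fun z => A z κ) x‖ ≤ B * (α₀ + α₁)) ∧
          IsLandau138 L k (((L : ℝ) ^ k)⁻¹) Set.univ (torusLam k) U₀ A ∧
          (∀ (μ : Fin d) (y : Site d) (κ : Fin d),
            ‖Ad (U₀ y μ) (covDerivFwd (((L : ℝ) ^ k)⁻¹) U₀ μ (fun z => A z κ) (y + e μ)) - covDerivFwd (((L : ℝ) ^ k)⁻¹) U₀ μ (fun z => A z κ) y‖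
              ≤ Bh * (α₀ + α₁) * (((L : ℝ)⁻¹) ^ k) ^ β) ∧
          (∀ (x : Site d) (κ : Fin d), ‖covLap (((L : ℝ) ^ k)⁻¹) U₀ (fun z => A z κ) x‖ ≤ B * (α₀ + α₁))))
    {dom : Set (Site d → Fin d → (Matrix n n ℂ)ˣ)}
    (h3 : LeafH3sup d L N ε b' c' dom) :
    ∀ k : ℕ, 1 ≤ k → ∀ V ∈ dom, ∀ UA UB : Site d → Fin d → (Matrix n n ℂ)ˣ,
      IsMinimiser d (sfClass d L N ε) L N k V UA → IsMinimiser d (sfClass d L N ε) L N (k + 1) V UB → Regular d L N b g (k + 1) UB →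
      ∃ u : Site d → (Matrix n n ℂ)ˣ, (∀ x, u x ∈ unitaryUnits (Matrix n n ℂ)) ∧ IsPeriodicSite u (((N * L ^ k : ℕ) : ℤ)) ∧
        (∃ Λ : ℕ → Set (Site d), Λ k = Set.univ ∧ Restr129 L k Λ (rescale L (bavg L UB)) u) ∧
        ∃ A : Site d → Fin d → Matrix n n ℂ,
          (∀ x μ, IsSelfAdjoint (A x μ)) ∧ (∀ (x : Site d) (κ μ : Fin d), A (x + (((N * L ^ k : ℕ) : ℤ)) • e κ) μ = A x μ) ∧
          mgauge (rescale L (bavg L UB)) u (cfgExp (((L : ℝ) ^ k)⁻¹) A)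
            = pert (gaugeAct (ptw L (rescale L (bavg L UB)) UA k) UA) (rescale L (bavg L UB)) ∧
          (∀ x μ, ‖A x μ‖ ≤ B * (α + 11 * (d : ℝ) ^ 2 * α)) ∧
          (∀ (μ : Fin d) (x : Site d) (κ : Fin d), ‖covDerivFwd (((L : ℝ) ^ k)⁻¹) (rescale L (bavg L UB)) μ (fun z => A z κ) x‖ ≤ B * (α + 11 * (d : ℝ) ^ 2 * α)) ∧
          IsLandau138 L k (((L : ℝ) ^ k)⁻¹) Set.univ (torusLam k) (rescale L (bavg L UB)) A ∧
          (∀ (μ : Fin d) (y : Site d) (κ : Fin d),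
            ‖Ad (rescale L (bavg L UB) y μ) (covDerivFwd (((L : ℝ) ^ k)⁻¹) (rescale L (bavg L UB)) μ (fun z => A z κ) (y + e μ))
                - covDerivFwd (((L : ℝ) ^ k)⁻¹) (rescale L (bavg L UB)) μ (fun z => A z κ) y‖
              ≤ Bh * (α + 11 * (d : ℝ) ^ 2 * α) * (((L : ℝ)⁻¹) ^ k) ^ β) ∧
          (∀ (x : Site d) (κ : Fin d), ‖covLap (((L : ℝ) ^ k)⁻¹) (rescale L (bavg L UB)) (fun z => A z κ) x‖ ≤ B * (α + 11 * (d : ℝ) ^ 2 * α)) := by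
  intro k hk V hV UA UB hA hB _
  have hL1 : 1 ≤ L := le_trans (by norm_num) hL
  have hL2 : (2 : ℝ) ≤ L := by exact_mod_cast hL
  -- both minimisers are `RegularSup b′ c′` by (H3ˢᵘᵖ) (levels `k ≥ 1`, `k + 1`)
  obtain ⟨k', rfl⟩ : ∃ k', k = k' + 1 := ⟨k - 1, by omega⟩
  have hregA : RegularSup d L N b' c' (k' + 1) UA := h3 V hV k' UA hA
  have hregB : RegularSup d L N b' c' (k' + 1 + 1) UB := h3 V hV (k' + 1) UB hB
  have hb4 : b' / ((L : ℝ) ^ (k' + 1)) ^ 2 ≤ 1 / 4 := by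
    have hLk2 : (2 : ℝ) ≤ (L : ℝ) ^ (k' + 1) := by
      calc (2 : ℝ) = 2 ^ 1 := by norm_num
        _ ≤ (L : ℝ) ^ 1 := by gcongr
        _ ≤ (L : ℝ) ^ (k' + 1) := pow_le_pow_right₀ (by linarith only [hL2]) (by omega)
    have h4 : (4 : ℝ) ≤ ((L : ℝ) ^ (k' + 1)) ^ 2 := by nlinarith only [hLk2]
    rw [div_le_div_iff₀ (by positivity) (by norm_num)]
    nlinarith only [h4, hb'1, hb']
  -- the pair's data: `W = rescale L (bavg L U_B)` and `U_A` unitary, periodic, small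
  obtain ⟨hAu, hAP, hAsm⟩ := hA.mem.1
  have hbs' : 512 * (d + 1) * (d + 4) * (L : ℝ) ^ 2 * b' ≤ 1 := by
    have hd0 : (0 : ℝ) ≤ d := Nat.cast_nonneg d
    have hL2b : 0 ≤ (L : ℝ) ^ 2 * b' := by positivity
    have hX : (4 : ℝ) ≤ ((d : ℝ) + 1) * ((d : ℝ) + 4) := by nlinarith only [hd0]
    have h1 : (512 : ℝ) * (d + 1) * (d + 4) ≤ 2 ^ 15 * ((d : ℝ) + 1) ^ 2 * ((d : ℝ) + 4) ^ 2 := by nlinarith only [hX, hd0]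
    calc 512 * (d + 1) * (d + 4) * (L : ℝ) ^ 2 * b' = (512 * (d + 1) * (d + 4)) * ((L : ℝ) ^ 2 * b') := by ring
      _ ≤ (2 ^ 15 * ((d : ℝ) + 1) ^ 2 * ((d : ℝ) + 4) ^ 2) * ((L : ℝ) ^ 2 * b') := mul_le_mul_of_nonneg_right h1 hL2b
      _ = 2 ^ 15 * ((d : ℝ) + 1) ^ 2 * ((d : ℝ) + 4) ^ 2 * (L : ℝ) ^ 2 * b' := by ring
      _ ≤ 1 := hRb
  obtain ⟨hWu, hWP, hWsm⟩ := rescale_bavg_mem_sfClass hL1 hb' hbs' le_rfl hregB.regular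
  have hαW0 : 0 ≤ b' + 226 * (8 * (d + 1) * (d + 4)) ^ 2 * b' ^ 2 := by positivity
  have h34 : pdev UA < α * (((L : ℝ) ^ (k' + 1))⁻¹) ^ 2 := by
    refine (pdev_le_of_smallField (div_nonneg hε (by positivity)) hAsm).trans_lt ?_
    rw [inv_pow, ← div_eq_mul_inv]; exact div_lt_div_of_pos_right hεα (by positivity)
  have h33 : pdev (rescale L (bavg L UB)) < α * (((L : ℝ) ^ (k' + 1))⁻¹) ^ 2 := by
    refine (pdev_le_of_smallField (div_nonneg hαW0 (by positivity)) hWsm).trans_lt ?_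
    rw [inv_pow, ← div_eq_mul_inv]; exact div_lt_div_of_pos_right hb'α (by positivity)
  have hpair : avgIter L UA (k' + 1) = avgIter L (rescale L (bavg L UB)) (k' + 1) := by
    rw [avgIter_eq_of_isMinimiser hA, avgIter_rescale_bavg_eq_of_isMinimiser hB]
  have hAshift : ∀ i : Fin d, shiftCfg (((N * L ^ (k' + 1) : ℕ) : ℤ) • e i) UA = UA := fun i => shiftCfg_of_isPeriodicCfg hAP (e i)
  have hWshift : ∀ i : Fin d, shiftCfg (((N * L ^ (k' + 1) : ℕ) : ℤ) • e i) (rescale L (bavg L UB)) = rescale L (bavg L UB) :=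
    fun i => shiftCfg_of_isPeriodicCfg hWP (e i)
  -- (1.33) first clause ∕ (1.34): both data in `𝔄_k({T_η}, α)` (n16-b's g0 `PairClassAkB8`)
  obtain ⟨hAkW, hAkA, -⟩ := inAk_pair hd hL1 hA hB hregA hregB hb' hc' hb4 hRb hα.le hb'α hc'α (fun _ => Set.univ)
    (u₀ := fun _ => (1 : (Matrix n n ℂ)ˣ)) (fun _ => (unitaryUnits (Matrix n n ℂ)).one_mem)
  -- (1.33) second clause: [Balaban1985BackgroundPropagators] (3.35) at `W` (n16-b's g2 `PairReg335B8`)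
  have hReg : Reg335Zd (((L : ℝ) ^ (k' + 1))⁻¹) L (𝒬 (k' + 1)) C (rescale L (bavg L UB)) :=
    reg335Zd_rescale_bavg hL1 hregB hb' hc' hRb hMc hMcα (h𝒬 (k' + 1)) hC
  -- Theorem 4 (torus geometry) applies at the pair (n16-b's F6): the unique periodic `u` with (1.29) on `Λ_k = T^{(k)}` and `Concl`
  obtain ⟨u, ⟨hu, huP, hres, hconcl⟩, -⟩ := by
    letI : CStarAlgebra (Matrix n n ℂ) := {}
    have hG := avgClosed_unitaryUnits d (𝔸 := Matrix n n ℂ) L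
    exact concl_of_thm4TorusAt_pair L hL hd hG N (k' + 1) (hT4 (k' + 1) hk) (rescale L (bavg L UB)) UA hWu hAu hWshift hAshift hα hα3
      hα2 h33 h34 hpair hsmall hc₁ hAkW hReg hAkA
  -- the Concl-dictionary: print's (1.36)∕(1.38)∕(1.62) letters at the pair
  -- the concrete conclusion slot: print's (1.36)∕(1.38)∕(1.39) letters at the pair
  obtain ⟨A, hAsa, hAper, hmg, hs, hg, h138, hhol, hlap⟩ := hconcl
  exact ⟨u, hu, huP, ⟨torusLam (k' + 1), torusLam_self _, hres⟩, A, hAsa, hAper, hmg, hs, hg, h138, hhol, hlap⟩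

/-! ## §2 The `d = 4` record knit with print's Theorem 4 (torus geometry, concrete conclusion) as the only N05-side hypothesis -/

/-- **N16 · NE3 BY NAME FROM [B8] THEOREM 4 (ALL-TORUS GEOMETRY, CONCLUSION IN PRINT's LETTERS) AND N07's INTERFACE — NO DICTIONARY BINDER** (`d = 4`; `L ≥ 2`,
`N ≥ 1`; Thm 4's constants `c₁`, `B`, `B_h`).  Statement in the module docstring (§3): the averaging letter `α` is quantified with its window DISPLAYED, the
(3.35) schedule as in file 4, and four k-free letter lines place Thm 4's output sizes `B(α + 176α)`, `B_h(α + 176α)` below THE END's letters `s₁`, `s₂`.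
File 9 §3 ∘ file 11 §3 ∘ §1 (= file 12 §1's road).  N16 ∕ NE3 NOT proved: (T4ᵀ_print) — [Balaban1985RegularSpaces] Thm 4 + Prop 3 at curved backgrounds, torus case — and (H3ˢᵘᵖ)
are the hypotheses. [folklore] -/
theorem n16_of_thm4TorusAt_print [Nonempty n] {L N : ℕ} (hL : 2 ≤ L) (hN : 1 ≤ N) :
    ∃ r : ℝ, 0 < r ∧ ∀ ⦃g : ℝ⦄, 0 < g → ∃ C : ℝ, 0 ≤ C ∧ ∀ (c₁ B Bh : ℝ) ⦃b' c' : ℝ⦄, 0 ≤ b' → 0 ≤ c' →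
      2 ^ 15 * ((4 : ℝ) + 1) ^ 2 * ((4 : ℝ) + 4) ^ 2 * (L : ℝ) ^ 2 * b' ≤ 1 →
      23040 * (4 : ℝ) ^ 4 * (frameC 4 L + 4) ^ 3 * (c' + curConst 4 L * b' ^ 2) ≤ 1 →
      ∀ ⦃α : ℝ⦄, 0 < α → C0 4 * α ≤ 1 / 3 → 2 * α ≤ c2' 4 L → 11 * (4 : ℝ) ^ 2 * α ≤ 1 / 6 → α + 11 * (4 : ℝ) ^ 2 * α ≤ c₁ →
      b' + 226 * (8 * ((4 : ℝ) + 1) * ((4 : ℝ) + 4)) ^ 2 * b' ^ 2 < α → 4 * ((4 : ℝ) - 1) * (c' + curConst 4 L * b' ^ 2) < α →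
      ∀ ⦃Mc : ℝ⦄, 0 ≤ Mc → (Mc + 1) * (b' + 226 * (8 * ((4 : ℝ) + 1) * ((4 : ℝ) + 4)) ^ 2 * b' ^ 2) ≤ 1 / 2 →
      ∀ (𝒬 : ℕ → Set (Set (Site 4) × ℕ)), (∀ k, ∀ q ∈ 𝒬 k, q.2 ≤ k ∧ ∃ y : Site 4, ∀ z ∈ q.1, (l1 (z - y) : ℝ) ≤ Mc * (L : ℝ) ^ q.2) →
      ∀ ⦃C335 : ℝ⦄, 2 * (Mc + 1) * (b' + 226 * (8 * ((4 : ℝ) + 1) * ((4 : ℝ) + 4)) ^ 2 * b' ^ 2) + 2 * Mc * (2 * (c' + curConst 4 L * b' ^ 2)) +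
        4 * Mc * (1 + 2 * Mc) * (b' + 226 * (8 * ((4 : ℝ) + 1) * ((4 : ℝ) + 4)) ^ 2 * b' ^ 2) ^ 2 < C335 →
      ∀ ⦃ε s₁ b s₂ : ℝ⦄, 0 < ε → ε ≤ r → ε < α → 0 ≤ s₁ → s₁ ≤ r → 0 ≤ b → b ≤ ε / 2 →
      B * (α + 11 * (4 : ℝ) ^ 2 * α) ≤ s₁ →
      B * (α + 11 * (4 : ℝ) ^ 2 * α) + 2 * (b' + 226 * (8 * ((4 : ℝ) + 1) * ((4 : ℝ) + 4)) ^ 2 * b' ^ 2) * s₁ ≤ s₁ →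
      B * (α + 11 * (4 : ℝ) ^ 2 * α) + 16 * (b' + 226 * (8 * ((4 : ℝ) + 1) * ((4 : ℝ) + 4)) ^ 2 * b' ^ 2) * (B * (α + 11 * (4 : ℝ) ^ 2 * α)) ≤ s₁ →
      Bh * (α + 11 * (4 : ℝ) ^ 2 * α) + 8 * (b' + 226 * (8 * ((4 : ℝ) + 1) * ((4 : ℝ) + 4)) ^ 2 * b' ^ 2) * (B * (α + 11 * (4 : ℝ) ^ 2 * α)) ≤ s₂ →
      (∀ k, 1 ≤ k → Thm4TorusAt L k (((N * L ^ k : ℕ) : ℤ)) (((L : ℝ) ^ k)⁻¹) c₁ (unitaryUnits (Matrix n n ℂ))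
        (Reg335Zd (((L : ℝ) ^ k)⁻¹) L (𝒬 k) C335) (Restr129 L k (torusLam k))
        (fun (α₀ α₁ : ℝ) (U₀ U' : Site 4 → Fin 4 → (Matrix n n ℂ)ˣ) (u : Site 4 → (Matrix n n ℂ)ˣ) =>
          ∃ A : Site 4 → Fin 4 → Matrix n n ℂ,
            (∀ x μ, IsSelfAdjoint (A x μ)) ∧ (∀ (x : Site 4) (κ μ : Fin 4), A (x + (((N * L ^ k : ℕ) : ℤ)) • e κ) μ = A x μ) ∧
            mgauge U₀ u (cfgExp (((L : ℝ) ^ k)⁻¹) A) = U' ∧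
            (∀ x μ, ‖A x μ‖ ≤ B * (α₀ + α₁)) ∧
            (∀ (μ : Fin 4) (x : Site 4) (κ : Fin 4), ‖covDerivFwd (((L : ℝ) ^ k)⁻¹) U₀ μ (fun z => A z κ) x‖ ≤ B * (α₀ + α₁)) ∧
            IsLandau138 L k (((L : ℝ) ^ k)⁻¹) Set.univ (torusLam k) U₀ A ∧
            (∀ (μ : Fin 4) (y : Site 4) (κ : Fin 4),
              ‖Ad (U₀ y μ) (covDerivFwd (((L : ℝ) ^ k)⁻¹) U₀ μ (fun z => A z κ) (y + e μ)) - covDerivFwd (((L : ℝ) ^ k)⁻¹) U₀ μ (fun z => A z κ) y‖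
                ≤ Bh * (α₀ + α₁) * (((L : ℝ)⁻¹) ^ k) ^ (1 : ℝ)) ∧
            (∀ (x : Site 4) (κ : Fin 4), ‖covLap (((L : ℝ) ^ k)⁻¹) U₀ (fun z => A z κ) x‖ ≤ B * (α₀ + α₁)))) →
      ∀ {dom : _root_.Set (Site 4 → Fin 4 → (Matrix n n ℂ)ˣ)},
        LeafH3sup 4 L N ε b' c' dom →
        NE3EnergyRateWCov 4 (sfClass 4 L N ε) L N b g C s₁ s₂ dom := by
  have hL1 : 1 ≤ L := by omega
  obtain ⟨r, hr0, hr⟩ := n16_of_thm4OutputLandau138 (n := n) hL hN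
  refine ⟨r, hr0, fun g hg => ?_⟩
  obtain ⟨C, hC0, hC⟩ := hr hg
  refine ⟨C, hC0, fun c₁ B Bh b' c' hb' hc' hRb hcF α hα hA3 hA2 hAs hAc hb'α hc'α Mc hMc hMcα 𝒬 h𝒬 C335 hC335 ε s₁ b s₂ hε hεr hεα hs₁ hs₁r hb hbh
    hss hgrad hℓ hhol hT4 dom h3 => ?_⟩
  have hC0' : 0 < C0 4 := C0_pos 4
  -- `α` sits below file 7's displayed `α₁`
  have hα1 : α ≤ 1 / (3 * C0 4) := by rw [le_div_iff₀ (by positivity)]; linarith only [hA3]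
  have hb'α₁ : b' + 226 * (8 * ((4 : ℝ) + 1) * ((4 : ℝ) + 4)) ^ 2 * b' ^ 2 < min (1 / (3 * C0 4)) (c2' 4 L / 2) :=
    lt_of_lt_of_le hb'α (le_min hα1 (by linarith only [hA2]))
  -- the sup letters' lines, cast to §2's shapes
  have hL1r : (1 : ℝ) ≤ L := by exact_mod_cast hL1
  have hb'1 : b' ≤ 1 := by
    have hL2 : (1 : ℝ) ≤ (L : ℝ) ^ 2 := one_le_pow₀ hL1r
    nlinarith only [hL2, hRb, hb']
  have hbs' : 512 * (((4 : ℕ) : ℝ) + 1) * (((4 : ℕ) : ℝ) + 4) * (L : ℝ) ^ 2 * b' ≤ 1 := by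
    have h0 : 0 ≤ (L : ℝ) ^ 2 * b' := by positivity
    push_cast; nlinarith only [h0, hRb]
  have hRb' : 2 ^ 15 * ((((4 : ℕ) : ℝ)) + 1) ^ 2 * ((((4 : ℕ) : ℝ)) + 4) ^ 2 * (L : ℝ) ^ 2 * b' ≤ 1 := by simpa only [Nat.cast_ofNat] using hRb
  have hb'α' : b' + 226 * (8 * ((4 : ℕ) + 1 : ℝ) * ((4 : ℕ) + 4 : ℝ)) ^ 2 * b' ^ 2 < α := by simpa using hb'α
  have hc'α' : 4 * ((((4 : ℕ) : ℝ)) - 1) * (c' + curConst 4 L * b' ^ 2) < α := by simpa only [Nat.cast_ofNat] using hc'α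
  have hAs' : 11 * (((4 : ℕ) : ℝ)) ^ 2 * α ≤ 1 / 6 := by simpa only [Nat.cast_ofNat] using hAs
  have hAc' : α + 11 * (((4 : ℕ) : ℝ)) ^ 2 * α ≤ c₁ := by simpa only [Nat.cast_ofNat] using hAc
  have hMcα' : (Mc + 1) * (b' + 226 * (8 * ((4 : ℕ) + 1 : ℝ) * ((4 : ℕ) + 4 : ℝ)) ^ 2 * b' ^ 2) ≤ 1 / 2 := by simpa using hMcα
  have hC335' : 2 * (Mc + 1) * (b' + 226 * (8 * ((4 : ℕ) + 1 : ℝ) * ((4 : ℕ) + 4 : ℝ)) ^ 2 * b' ^ 2) + 2 * Mc * (2 * (c' + curConst 4 L * b' ^ 2)) +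
      4 * Mc * (1 + 2 * Mc) * (b' + 226 * (8 * ((4 : ℕ) + 1 : ℝ) * ((4 : ℕ) + 4 : ℝ)) ^ 2 * b' ^ 2) ^ 2 < C335 := by simpa using hC335
  -- (T4ᵀ_print) at the pairs (§1), then the dictionaries (file 11 §3), then THE END (file 9 §3)
  have hOutP := thm4OutputPrint_of_thm4TorusAt_print (d := 4) (b := b) (g := g) (by norm_num) hL hε.le hb' hc' hb'1 hRb' hb'α' hc'α' hα hεα hA3 hA2 hAs' hAc'
    hMc hMcα' h𝒬 hC335' hT4 h3
  have hss' : B * (α + 11 * (((4 : ℕ) : ℝ)) ^ 2 * α) ≤ s₁ := by simpa only [Nat.cast_ofNat] using hss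
  have hgrad' : B * (α + 11 * (((4 : ℕ) : ℝ)) ^ 2 * α) + 2 * (b' + 226 * (8 * ((4 : ℝ) + 1) * ((4 : ℝ) + 4)) ^ 2 * b' ^ 2) * s₁ ≤ s₁ := by
    simpa only [Nat.cast_ofNat] using hgrad
  have hℓ' : B * (α + 11 * (((4 : ℕ) : ℝ)) ^ 2 * α) +
      4 * ((4 : ℕ) : ℝ) * (b' + 226 * (8 * (((4 : ℕ) : ℝ) + 1) * (((4 : ℕ) : ℝ) + 4)) ^ 2 * b' ^ 2) * (B * (α + 11 * (((4 : ℕ) : ℝ)) ^ 2 * α)) ≤ s₁ := by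
    push_cast at hℓ ⊢; linarith only [hℓ]
  have hhol' : Bh * (α + 11 * (((4 : ℕ) : ℝ)) ^ 2 * α) +
      8 * (b' + 226 * (8 * (((4 : ℕ) : ℝ) + 1) * (((4 : ℕ) : ℝ) + 4)) ^ 2 * b' ^ 2) * (B * (α + 11 * (((4 : ℕ) : ℝ)) ^ 2 * α)) ≤ s₂ := by
    push_cast at hhol ⊢; linarith only [hhol]
  exact hC hb' hc' hRb hcF hb'α₁ hε hεr hs₁ hs₁r hb hbh hgrad' s₂
    (thm4OutputLandau138_of_thm4OutputPrint hL hb' hbs' le_rfl hss' hhol' hℓ' hOutP h3) h3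

/-! ## §3 The DECL column with print's Theorem 4 (torus geometry, concrete conclusion) as the only N05-side hypothesis -/

/-- **N16 · THE ROW's DECL FROM [B8] THEOREM 4 (ALL-TORUS GEOMETRY, CONCLUSION IN PRINT's LETTERS) AND N07's INTERFACE — NO DICTIONARY BINDER** (`d = 4`;
`L ≥ 2`, `N ≥ 1`): `∃ r > 0` (THE END's), then for Theorem 4's constants `(c₁, B, B_h)`, g2's numeric regime, the averaging letter `α` in its displayed window
(`C₀α ≤ ⅓`, `2α ≤ c₂′`, `176α ≤ ⅙`, `177α ≤ c₁`, the two leaf lines `< α`, `ε < α`), the (3.35) schedule `(Mc, 𝒬, C₃₃₅)`, four k-free letter lines placing `177Bα`,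
`177B_hα` below `s₁`, `s₂`: (T4ᵀ_print) `∀ k ≥ 1, Thm4TorusAt L k (N·Lᵏ) (Lᵏ)⁻¹ c₁ unitaryUnits (Reg335Zd (Lᵏ)⁻¹ L (𝒬 k) C₃₃₅) (Restr129 L k (torusLam k))
Concl_print(B, B_h)` → `dom ⊆ sfClass 4 L N ε₁ 0` → `LeafH3sup 4 L N ε b c dom` → the DECL conclusion.  File 9 §4 ∘ file 11 §3 ∘ §1 (= file 12 §2's road).  N16 ∕ NE3 NOT proved.
[folklore] -/
theorem ne3Shape_of_thm4TorusAt_print [Nonempty n] {L N : ℕ} (hL : 2 ≤ L) (hN : 1 ≤ N) :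
    ∃ r : ℝ, 0 < r ∧ ∀ (c₁ B Bh : ℝ) ⦃ε s₁ t b c ε₁ : ℝ⦄, 0 < ε → ε ≤ r → 0 ≤ s₁ → s₁ ≤ r →
      0 ≤ b → b ≤ t → 0 < c → c ≤ t →
      (2 : ℝ) ^ 91 * (L : ℝ) ^ 17 * t ≤ 1 → (2 : ℝ) ^ 76 * (L : ℝ) ^ 12 * t ≤ ε →
      16 * C0 4 * ε ≤ 3 → 1024 * (4 + 1) * (4 + 4) * (L : ℝ) ^ 2 * ε ≤ 1 → b ≤ ε / 2 →
      23040 * (4 : ℝ) ^ 4 * (frameC 4 L + 4) ^ 3 * (c + curConst 4 L * b ^ 2) ≤ 1 →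
      ε₁ ≤ 1 / 4 → ε₁ ≤ b → 4 * ε₁ ≤ c →
      ∀ ⦃α : ℝ⦄, 0 < α → ε < α → C0 4 * α ≤ 1 / 3 → 2 * α ≤ c2' 4 L → 11 * (4 : ℝ) ^ 2 * α ≤ 1 / 6 → α + 11 * (4 : ℝ) ^ 2 * α ≤ c₁ →
      (b + 226 * (8 * ((4 : ℝ) + 1) * ((4 : ℝ) + 4)) ^ 2 * b ^ 2) < α → 4 * ((4 : ℝ) - 1) * (c + curConst 4 L * b ^ 2) < α →
      ∀ ⦃Mc : ℝ⦄, 0 ≤ Mc → (Mc + 1) * (b + 226 * (8 * ((4 : ℝ) + 1) * ((4 : ℝ) + 4)) ^ 2 * b ^ 2) ≤ 1 / 2 →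
      ∀ (𝒬 : ℕ → Set (Set (Site 4) × ℕ)), (∀ k, ∀ q ∈ 𝒬 k, q.2 ≤ k ∧ ∃ y : Site 4, ∀ z ∈ q.1, (l1 (z - y) : ℝ) ≤ Mc * (L : ℝ) ^ q.2) →
      ∀ ⦃C335 : ℝ⦄, 2 * (Mc + 1) * (b + 226 * (8 * ((4 : ℝ) + 1) * ((4 : ℝ) + 4)) ^ 2 * b ^ 2) + 2 * Mc * (2 * (c + curConst 4 L * b ^ 2)) +
        4 * Mc * (1 + 2 * Mc) * (b + 226 * (8 * ((4 : ℝ) + 1) * ((4 : ℝ) + 4)) ^ 2 * b ^ 2) ^ 2 < C335 →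
      ∀ ⦃s₂ : ℝ⦄, B * (α + 11 * (4 : ℝ) ^ 2 * α) ≤ s₁ →
      B * (α + 11 * (4 : ℝ) ^ 2 * α) + 2 * (b + 226 * (8 * ((4 : ℝ) + 1) * ((4 : ℝ) + 4)) ^ 2 * b ^ 2) * s₁ ≤ s₁ →
      B * (α + 11 * (4 : ℝ) ^ 2 * α) + 16 * (b + 226 * (8 * ((4 : ℝ) + 1) * ((4 : ℝ) + 4)) ^ 2 * b ^ 2) * (B * (α + 11 * (4 : ℝ) ^ 2 * α)) ≤ s₁ →
      Bh * (α + 11 * (4 : ℝ) ^ 2 * α) + 8 * (b + 226 * (8 * ((4 : ℝ) + 1) * ((4 : ℝ) + 4)) ^ 2 * b ^ 2) * (B * (α + 11 * (4 : ℝ) ^ 2 * α)) ≤ s₂ →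
      (∀ k, 1 ≤ k → Thm4TorusAt L k (((N * L ^ k : ℕ) : ℤ)) (((L : ℝ) ^ k)⁻¹) c₁ (unitaryUnits (Matrix n n ℂ))
        (Reg335Zd (((L : ℝ) ^ k)⁻¹) L (𝒬 k) C335) (Restr129 L k (torusLam k))
        (fun (α₀ α₁ : ℝ) (U₀ U' : Site 4 → Fin 4 → (Matrix n n ℂ)ˣ) (u : Site 4 → (Matrix n n ℂ)ˣ) =>
          ∃ A : Site 4 → Fin 4 → Matrix n n ℂ,
            (∀ x μ, IsSelfAdjoint (A x μ)) ∧ (∀ (x : Site 4) (κ μ : Fin 4), A (x + (((N * L ^ k : ℕ) : ℤ)) • e κ) μ = A x μ) ∧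
            mgauge U₀ u (cfgExp (((L : ℝ) ^ k)⁻¹) A) = U' ∧
            (∀ x μ, ‖A x μ‖ ≤ B * (α₀ + α₁)) ∧
            (∀ (μ : Fin 4) (x : Site 4) (κ : Fin 4), ‖covDerivFwd (((L : ℝ) ^ k)⁻¹) U₀ μ (fun z => A z κ) x‖ ≤ B * (α₀ + α₁)) ∧
            IsLandau138 L k (((L : ℝ) ^ k)⁻¹) Set.univ (torusLam k) U₀ A ∧
            (∀ (μ : Fin 4) (y : Site 4) (κ : Fin 4),
              ‖Ad (U₀ y μ) (covDerivFwd (((L : ℝ) ^ k)⁻¹) U₀ μ (fun z => A z κ) (y + e μ)) - covDerivFwd (((L : ℝ) ^ k)⁻¹) U₀ μ (fun z => A z κ) y‖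
                ≤ Bh * (α₀ + α₁) * (((L : ℝ)⁻¹) ^ k) ^ (1 : ℝ)) ∧
            (∀ (x : Site 4) (κ : Fin 4), ‖covLap (((L : ℝ) ^ k)⁻¹) U₀ (fun z => A z κ) x‖ ≤ B * (α₀ + α₁)))) →
      ∀ {dom : Set (Site 4 → Fin 4 → (Matrix n n ℂ)ˣ)}, dom ⊆ sfClass 4 L N ε₁ 0 →
        LeafH3sup 4 L N ε b c dom →
        (∃ sel : ℕ → (Site 4 → Fin 4 → (Matrix n n ℂ)ˣ) → (Site 4 → Fin 4 → (Matrix n n ℂ)ˣ),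
            ∀ V ∈ dom, ∀ k : ℕ, IsMinimiser 4 (sfClass 4 L N ε) L N k V (sel k V) ∧ RegularSup 4 L N b c k (sel k V)) ∧
        ∀ sel : ℕ → (Site 4 → Fin 4 → (Matrix n n ℂ)ˣ) → (Site 4 → Fin 4 → (Matrix n n ℂ)ˣ),
          (∀ V ∈ dom, ∀ k : ℕ, IsMinimiser 4 (sfClass 4 L N ε) L N k V (sel k V)) →
          (∀ V ∈ dom, ∀ k : ℕ, RegularSup 4 L N b c k (sel k V)) →
          ∃ C' : ℝ, 0 ≤ C' ∧
            NE3Shape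
              (minActReadings 4 (sfClass 4 L N ε) L N dom
                (fun k V (x : ↥(periodBox (d := 4) N)) =>
                  fineAction (sel k V) (((blockSites L)^[k] {(x : Site 4)}) ×ˢ Finset.univ)))
              C' ((L : ℝ)⁻¹) := by
  have hL1 : 1 ≤ L := by omega
  obtain ⟨r, hr0, hr⟩ := ne3Shape_of_thm4OutputLandau138 (n := n) hL hN
  refine ⟨r, hr0, fun c₁ B Bh ε s₁ t b c ε₁ hε hεr hs₁ hs₁r hb hbt hc hct hsmall hεt hε1 hε2 hbε hcF hε₁ hε₁b hε₁c α hα hεα hA3 hA2 hAs hAc hbα hcα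
    Mc hMc hMcα 𝒬 h𝒬 C335 hC335 s₂ hss hgrad hℓ hhol hT4 dom hdom h3 => ?_⟩
  have hC0' : 0 < C0 4 := C0_pos 4
  have hα1 : α ≤ 1 / (3 * C0 4) := by rw [le_div_iff₀ (by positivity)]; linarith only [hA3]
  have hbα₁ : b + 226 * (8 * ((4 : ℝ) + 1) * ((4 : ℝ) + 4)) ^ 2 * b ^ 2 < min (1 / (3 * C0 4)) (c2' 4 L / 2) :=
    lt_of_lt_of_le hbα (le_min hα1 (by linarith only [hA2]))
  -- the sup letters' lines, cast to file 12 §2's shapes ((Rb) for `b` from the numeral, as in g2's knit)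
  have hL1r : (1 : ℝ) ≤ L := by exact_mod_cast hL1
  have hRb0 : 2 ^ 15 * ((4 : ℝ) + 1) ^ 2 * ((4 : ℝ) + 4) ^ 2 * (L : ℝ) ^ 2 * b ≤ 1 := by
    have h2 : (L : ℝ) ^ 2 ≤ (L : ℝ) ^ 17 := pow_le_pow_right₀ hL1r (by norm_num)
    have e : 2 ^ 15 * ((4 : ℝ) + 1) ^ 2 * ((4 : ℝ) + 4) ^ 2 * (L : ℝ) ^ 2 * b = 52428800 * ((L : ℝ) ^ 2 * b) := by ring
    rw [e]
    have h5 : (L : ℝ) ^ 2 * b ≤ (L : ℝ) ^ 17 * t := mul_le_mul h2 hbt hb (by positivity)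
    have h6 : (2 : ℝ) ^ 91 * ((L : ℝ) ^ 17 * t) ≤ 1 := by linarith only [hsmall]
    have h7 : 0 ≤ (L : ℝ) ^ 17 * t := le_trans (by positivity) h5
    linarith only [h5, h6, h7]
  have hb1 : b ≤ 1 := by
    have hL2 : (1 : ℝ) ≤ (L : ℝ) ^ 2 := one_le_pow₀ hL1r
    nlinarith only [hL2, hRb0, hb]
  have hbs : 512 * (((4 : ℕ) : ℝ) + 1) * (((4 : ℕ) : ℝ) + 4) * (L : ℝ) ^ 2 * b ≤ 1 := by
    have h0 : 0 ≤ (L : ℝ) ^ 2 * b := by positivity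
    push_cast; nlinarith only [h0, hRb0]
  have hRb : 2 ^ 15 * ((((4 : ℕ) : ℝ)) + 1) ^ 2 * ((((4 : ℕ) : ℝ)) + 4) ^ 2 * (L : ℝ) ^ 2 * b ≤ 1 := by simpa only [Nat.cast_ofNat] using hRb0
  have hbα' : b + 226 * (8 * ((4 : ℕ) + 1 : ℝ) * ((4 : ℕ) + 4 : ℝ)) ^ 2 * b ^ 2 < α := by simpa using hbα
  have hcα' : 4 * ((((4 : ℕ) : ℝ)) - 1) * (c + curConst 4 L * b ^ 2) < α := by simpa only [Nat.cast_ofNat] using hcα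
  have hAs' : 11 * (((4 : ℕ) : ℝ)) ^ 2 * α ≤ 1 / 6 := by simpa only [Nat.cast_ofNat] using hAs
  have hAc' : α + 11 * (((4 : ℕ) : ℝ)) ^ 2 * α ≤ c₁ := by simpa only [Nat.cast_ofNat] using hAc
  have hMcα' : (Mc + 1) * (b + 226 * (8 * ((4 : ℕ) + 1 : ℝ) * ((4 : ℕ) + 4 : ℝ)) ^ 2 * b ^ 2) ≤ 1 / 2 := by simpa using hMcα
  have hC335' : 2 * (Mc + 1) * (b + 226 * (8 * ((4 : ℕ) + 1 : ℝ) * ((4 : ℕ) + 4 : ℝ)) ^ 2 * b ^ 2) + 2 * Mc * (2 * (c + curConst 4 L * b ^ 2)) +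
      4 * Mc * (1 + 2 * Mc) * (b + 226 * (8 * ((4 : ℕ) + 1 : ℝ) * ((4 : ℕ) + 4 : ℝ)) ^ 2 * b ^ 2) ^ 2 < C335 := by simpa using hC335
  have hOutP := thm4OutputPrint_of_thm4TorusAt_print (d := 4) (b := b) (g := gradConst 4 c) (by norm_num) hL hε.le hb hc.le hb1 hRb hbα' hcα' hα hεα
    hA3 hA2 hAs' hAc' hMc hMcα' h𝒬 hC335' hT4 h3
  have hss' : B * (α + 11 * (((4 : ℕ) : ℝ)) ^ 2 * α) ≤ s₁ := by simpa only [Nat.cast_ofNat] using hss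
  have hgrad' : B * (α + 11 * (((4 : ℕ) : ℝ)) ^ 2 * α) + 2 * (b + 226 * (8 * ((4 : ℝ) + 1) * ((4 : ℝ) + 4)) ^ 2 * b ^ 2) * s₁ ≤ s₁ := by
    simpa only [Nat.cast_ofNat] using hgrad
  have hℓ' : B * (α + 11 * (((4 : ℕ) : ℝ)) ^ 2 * α) +
      4 * ((4 : ℕ) : ℝ) * (b + 226 * (8 * (((4 : ℕ) : ℝ) + 1) * (((4 : ℕ) : ℝ) + 4)) ^ 2 * b ^ 2) * (B * (α + 11 * (((4 : ℕ) : ℝ)) ^ 2 * α)) ≤ s₁ := by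
    push_cast at hℓ ⊢; linarith only [hℓ]
  have hhol' : Bh * (α + 11 * (((4 : ℕ) : ℝ)) ^ 2 * α) +
      8 * (b + 226 * (8 * (((4 : ℕ) : ℝ) + 1) * (((4 : ℕ) : ℝ) + 4)) ^ 2 * b ^ 2) * (B * (α + 11 * (((4 : ℕ) : ℝ)) ^ 2 * α)) ≤ s₂ := by
    push_cast at hhol ⊢; linarith only [hhol]
  exact hr hε hεr hs₁ hs₁r hb hbt hc hct hsmall hεt hε1 hε2 hbε hcF hbα₁ hε₁ hε₁b hε₁c hgrad' s₂ hdom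
    (thm4OutputLandau138_of_thm4OutputPrint hL hb hbs le_rfl hss' hhol' hℓ' hOutP h3) h3

end

end Summit.QuantumFields.YangMills.BalabanUVNodes.N16
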